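import Summits.BirchSwinnertonDyer.BirchSwinnertonDyer.Theorems.Rank1ResidualX9Defs
import Literature.NumberTheory.EllipticCurves.LeadingTermPPartEisensteinProofs
import Literature.NumberTheory.EllipticCurves.AnalyticRankOrderProofs
import Literature.NumberTheory.EllipticCurves.Rank1Residual.Typed.X9
import HarnessLib

/-!
# BSD rank-≤1 residual cell, class X9: the typed missing input SUFFICES in analytic rank 0

HONEST FRAMING (cell `b2b-bsdres-*`, verbatim): the goal of the cell is to DELETE the
COMBINATION-SHAPED residual classes for ALL analytic-rank ≤ 1 curves over ℚ — "full BSD formula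
for every rank ≤ 1 curve in class C" assembled STRICTLY from published theorems — so that the
rank-≤1 remainder becomes exactly the CONSTRUCTION-SHAPED classes, which are TYPED (missing-input
Props), NOT attempted; this is not "finishing BSD".

Theorems only (helper file of the statement item `SelmerRankSmallImage`,
stmt-BirchSwinnertonDyer-14418, like `Rank1ResidualX9Defs.lean`).  Gen 1 of the X9 seat TYPED the
class: target `BSDpOnClassX9` and missing input `IntegralMainConjectureOnClassX9` (the INTEGRAL
cyclotomic main conjecture `ch_Λ X(E/ℚ_∞) = (g)`, `ι g = L_p(f, α)`, at a prime of class X9 —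
BCS 2025 Thm. 1.1.2 (b)'s conclusion without its hypothesis (im), which is false on X9).  This file
closes the loop for analytic rank `0`: **the typed missing input, together with the same PUBLISHED
inputs the cell's other rank-0 theorems use (Greenberg LNM 1716 Thm. 4.1, inline `hGr`; the
`p`-adic unit `ϖ = Ω⁺_f/Ω_E` at an irreducible prime, Skinner–Urban 2014 p. 45 /
Greenberg–Vatsal 2000 §3, inline `hϖ`; modularity with an integral Manin constant
`nonempty_modularParametrizationData`; analytic continuation `hasEntireLFunction_rat`;
Gross–Zagier–Kolyvagin `rank_eq_analyticRank_of_analyticRank_le_one`), implies Miller's `BSD(E,p)`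
for every X9 pair of analytic rank 0** — so the typed input is not only necessary-looking but
sufficient: X9 ∧ `r = 0` is EXACTLY one integral main conjecture away from closed.  The deduction
is the tree's `padicValRat_bsd_rank_zero_of_mazurMainConjecture` (Castella–Grossi–Lee–Skinner 2022,
proof of Thm. 5.1.4: interpolation `g(0) = (1 - α⁻¹)² L(E,1)/Ω`, Greenberg's Euler characteristic,
cancellation of the anomalous factor), fed with the Néron-normalised generator `ϖ · g`, which
generates the same ideal because `ord_p ϖ = 0` under (irr).  Rank 1 is NOT touched (its engine, the
integral BDP anticyclotomic main conjecture without (sur), has no tree vocabulary — see the TODO in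
`Rank1ResidualX9Defs.lean`).

* `bsdp_of_integralMainConjectureOnClassX9_of_analyticRank_eq_zero` — the rank-0 class theorem
  conditional on the typed input (canonical cell shape, over the literature seat's `ClassX9`).
* `missingInputAt_of_integralMainConjectureOnClassX9_of_analyticRank_eq_zero` — hence the
  Literature-side type `Typed.X9.MissingInputAt W p` (`Rank1Residual/Typed/X9.lean`) is inhabited
  from the Summits-side typed input in rank 0: the two typings agree.
-/

set_option linter.dupNamespace false

noncomputable section

open scoped Classical MatrixGroups ModularForm

open CongruenceSubgroup WeierstrassCurve Literature.NumberTheory.EllipticCurves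
  Literature.NumberTheory.EllipticCurves.ModularForms
  Literature.NumberTheory.EllipticCurves.Rank1Residual

namespace Summit.BirchSwinnertonDyer.BirchSwinnertonDyer.Rank1Residual

/-- **Class X9, analytic rank 0: the typed missing input ⟹ `BSD(E,p)`.**  Hypotheses: the typed
missing input `h : IntegralMainConjectureOnClassX9` (integral cyclotomic IMC at X9 primes, OPEN —
this is what makes the theorem conditional); PUBLISHED inputs, spelled exactly as in the tree's
`padicValRat_bsd_rank_zero_of_mainConjecture`: modularity with integral Manin constant (`hmodP`),
Greenberg LNM 1716 Thm. 4.1 (`hGr`, inline), the period unit `ord_p(Ω⁺_f/Ω_E) = 0` at an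
irreducible good odd `p` (`hϖ`, inline; Skinner–Urban 2014 p. 45), analytic continuation (`hmodL`,
for `r_an = 0 ⇒ L(E,1) ≠ 0`) and Gross–Zagier–Kolyvagin (`hGZK`).  Conclusion: for `W` globally
minimal with `Rank1Residual.ClassX9 W p` and `W.analyticRank = 0`, Miller's `BSDp W p`.  Proof: the
typed input gives `ch X = (g)`, `ι g = L_p(f, α)`; since `ord_p ϖ = 0`, `ϖ` is a unit of `ℤ_p` and
`ϖ g` generates the same ideal with `ι(ϖ g) = ϖ · L_p(f, α)` — Mazur's normalisation — so
`padicValRat_bsd_rank_zero_of_mazurMainConjecture` (CGLS 2022, proof of Thm. 5.1.4) yields the print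
shape and `bsdp_of_padicValRat_rank_zero` the `BSD(E,p)` statement.
[cite: CastellaEtAl2021, Thm. 5.1.4 and its proof (§5.1.3)] [cite: GreenbergLNM1716, Thm. 4.1 (p. 102)] [cite: SkinnerUrban2014, §3.6.7 (p. 45)] -/
theorem bsdp_of_integralMainConjectureOnClassX9_of_analyticRank_eq_zero
    (h : IntegralMainConjectureOnClassX9)
    (hmodP : nonempty_modularParametrizationData)
    (hGr : ∀ (W : WeierstrassCurve ℚ) [W.IsElliptic] [W.IsGloballyMinimal] (p : ℕ) [Fact p.Prime],
      p ≠ 2 → W.HasGoodReductionAtPrime p → ¬ (p : ℤ) ∣ W.frobeniusTrace p →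
      ∀ (κ : ZpExtension ℚ p) (γ : Field.absoluteGaloisGroup ℚ),
        κ.IsCyclotomic → κ.IsTopGenerator γ → IsCyclotomicVariable p γ →
      ∀ (D : W.SelmerDualData κ γ) [Module.Finite (IwasawaAlgebra p) D.X], D.IsTorsion →
      ∀ (fE : IwasawaAlgebra p), D.charIdeal = Ideal.span {fE} →
        Finite (W.selmerGroupPInfty p) →
        ∃ u : ℤ_[p]ˣ,
          ((PowerSeries.constantCoeff fE : ℤ_[p]) : ℚ_[p]) *
              (Nat.card (AddCommGroup.primaryComponent W.toAffine.Point p) : ℚ_[p]) ^ 2 =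
            ((u : ℤ_[p]) : ℚ_[p]) * (p : ℚ_[p]) ^ (padicValNat p W.tamagawaProduct) *
              (Nat.card (AddCommGroup.primaryComponent
                ((integralModelInt W).map (Int.castRingHom (ZMod p))).toAffine.Point p) : ℚ_[p]) ^ 2 *
              (Nat.card (W.selmerGroupPInfty p) : ℚ_[p]))
    (hϖ : ∀ (W : WeierstrassCurve ℚ) [W.IsElliptic] [W.IsGloballyMinimal] (p : ℕ) [Fact p.Prime],
      p ≠ 2 → W.HasGoodReductionAtPrime p → W.HasIrreducibleModPGaloisRep p →
      ∀ [NeZero (W.conductorNorm ℤ)] (f : CuspForm (Gamma0 (W.conductorNorm ℤ)) 2),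
        IsNewformOf W f →
      ∀ ϖ : ℚ, (ϖ : ℝ) * W.realPeriodRat = plusPeriod f → padicValRat p ϖ = 0)
    (hmodL : hasEntireLFunction_rat) (hGZK : rank_eq_analyticRank_of_analyticRank_le_one)
    (W : WeierstrassCurve ℚ) [W.IsElliptic] [W.IsGloballyMinimal] (p : ℕ) [Fact p.Prime]
    (hX9 : Literature.NumberTheory.EllipticCurves.Rank1Residual.ClassX9 W p)
    (hr : W.analyticRank = 0) : BSDp W p := by
  have hpP : p.Prime := Fact.out
  have hX : ClassX9 W p := classX9_of_classX9_census W p hX9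
  obtain ⟨-, h5, hgood, hord, hirr, -⟩ := id hX
  have hp2 : p ≠ 2 := by omega
  have hL : W.entireLFunction 1 ≠ 0 := (W.analyticRank_eq_zero_iff_holds (hmodL W)).1 hr
  have hfin : Finite W.sha := (hGZK W (by omega)).2
  have hΩ : 0 < W.realPeriodRat := W.realPeriodRat_pos_holds
  refine bsdp_of_padicValRat_rank_zero W p hr hL hGZK
    (padicValRat_bsd_rank_zero_of_mazurMainConjecture W p hgood hord hL hfin hmodP
      (hGr W p hp2 hgood hord) ?_)
  -- Mazur's main conjecture in the Néron normalisation, from the typed input and the unit `ϖ`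
  intro κ γ hκ hγ hγ' _ f hf ϖ hϖeq D
  obtain ⟨htors, g, hchar, hιg⟩ := h W p κ γ f hX hκ hγ hγ' hf D
  -- `ϖ ≠ 0`: `L(E,1) = [0]⁺_f · Ω⁺_f ≠ 0` forces `Ω⁺_f ≠ 0`
  have hplus : plusPeriod f ≠ 0 := by
    intro h0
    apply hL
    rw [hf.entireLFunction_one_eq, h0]
    simp
  have hϖ0 : ϖ ≠ 0 := by
    rintro rfl
    apply hplus
    rw [← hϖeq]
    simp
  -- `ord_p ϖ = 0`, so `ϖ` is a unit of `ℤ_p`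
  have hval : padicValRat p ϖ = 0 := hϖ W p hp2 hgood hirr f hf ϖ hϖeq
  have hnorm : ‖(ϖ : ℚ_[p])‖ = 1 := by
    rw [Padic.eq_padicNorm, padicNorm.eq_zpow_of_nonzero hϖ0, hval, neg_zero, zpow_zero,
      Rat.cast_one]
  set c : ℤ_[p] := ⟨(ϖ : ℚ_[p]), hnorm.le⟩ with hc_def
  have hcu : IsUnit c := PadicInt.isUnit_iff.mpr hnorm
  refine ⟨htors, PowerSeries.C c * g, ?_, ?_⟩
  · rw [hchar]
    exact (Ideal.span_singleton_mul_left_unit (hcu.map PowerSeries.C) g).symm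
  · rw [map_mul, hιg, PowerSeries.map_C]
    rfl

/-- **Hence the Literature-side type is inhabited from the Summits-side typed input (rank 0).**
Under the same hypotheses, `Typed.X9.MissingInputAt W p` (`Rank1Residual/Typed/X9.lean`: Miller's
last clause `#Ш_an = q`, `ord_p q = ord_p #Ш`) holds at every X9 pair of analytic rank `0`: the
two typings of the X9 residue agree in rank `0`, the Summits one being the finer (it names the
OBJECT — an integral main conjecture — whose output the Literature one records).
[cite: Miller2011LMS, Def. 1.1] [cite: CastellaEtAl2021, Thm. 5.1.4 and its proof (§5.1.3)] -/
theorem missingInputAt_of_integralMainConjectureOnClassX9_of_analyticRank_eq_zero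
    (h : IntegralMainConjectureOnClassX9)
    (hmodP : nonempty_modularParametrizationData)
    (hGr : ∀ (W : WeierstrassCurve ℚ) [W.IsElliptic] [W.IsGloballyMinimal] (p : ℕ) [Fact p.Prime],
      p ≠ 2 → W.HasGoodReductionAtPrime p → ¬ (p : ℤ) ∣ W.frobeniusTrace p →
      ∀ (κ : ZpExtension ℚ p) (γ : Field.absoluteGaloisGroup ℚ),
        κ.IsCyclotomic → κ.IsTopGenerator γ → IsCyclotomicVariable p γ →
      ∀ (D : W.SelmerDualData κ γ) [Module.Finite (IwasawaAlgebra p) D.X], D.IsTorsion →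
      ∀ (fE : IwasawaAlgebra p), D.charIdeal = Ideal.span {fE} →
        Finite (W.selmerGroupPInfty p) →
        ∃ u : ℤ_[p]ˣ,
          ((PowerSeries.constantCoeff fE : ℤ_[p]) : ℚ_[p]) *
              (Nat.card (AddCommGroup.primaryComponent W.toAffine.Point p) : ℚ_[p]) ^ 2 =
            ((u : ℤ_[p]) : ℚ_[p]) * (p : ℚ_[p]) ^ (padicValNat p W.tamagawaProduct) *
              (Nat.card (AddCommGroup.primaryComponent
                ((integralModelInt W).map (Int.castRingHom (ZMod p))).toAffine.Point p) : ℚ_[p]) ^ 2 *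
              (Nat.card (W.selmerGroupPInfty p) : ℚ_[p]))
    (hϖ : ∀ (W : WeierstrassCurve ℚ) [W.IsElliptic] [W.IsGloballyMinimal] (p : ℕ) [Fact p.Prime],
      p ≠ 2 → W.HasGoodReductionAtPrime p → W.HasIrreducibleModPGaloisRep p →
      ∀ [NeZero (W.conductorNorm ℤ)] (f : CuspForm (Gamma0 (W.conductorNorm ℤ)) 2),
        IsNewformOf W f →
      ∀ ϖ : ℚ, (ϖ : ℝ) * W.realPeriodRat = plusPeriod f → padicValRat p ϖ = 0)
    (hmodL : hasEntireLFunction_rat) (hGZK : rank_eq_analyticRank_of_analyticRank_le_one)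
    (W : WeierstrassCurve ℚ) [W.IsElliptic] [W.IsGloballyMinimal] (p : ℕ) [Fact p.Prime]
    (hX9 : Literature.NumberTheory.EllipticCurves.Rank1Residual.ClassX9 W p)
    (hr : W.analyticRank = 0) : Typed.X9.MissingInputAt W p := by
  haveI : Finite W.sha := (hGZK W (by omega)).2
  exact Typed.X9.missingInputAt_of_bsdp W p
    (bsdp_of_integralMainConjectureOnClassX9_of_analyticRank_eq_zero h hmodP hGr hϖ hmodL hGZK W p
      hX9 hr)

end Summit.BirchSwinnertonDyer.BirchSwinnertonDyer.Rank1Residual
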